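import Summits.NavierStokesRegularity.NavierStokesRegularity.Theorems.WakeRatchetEternalInviscidRateLeakRatchet

/-!
# Crux `WakeRatchet.EternalInviscidRate` (⟨stmt-NavierStokesRegularity-25646⟩, K1⁰ RATE) BY NAME from ONE analytic hypothesis:
# a UNIFORM ACTION BUDGET in self-similar units

The landed LEAK RATCHET (`FinalWakeLedger.tail_succ_le_leak_envelope`, p817248) says: for every uniformly bounded admissible
inviscid eternal solution `W` of a cancelling table, if the physical tail above shell `n` is `≤ M` at all log-times then the tail
above `n+1` is `≤ (1 − e^{−2C_AΛ⁻¹A_{n+1}})·M` at all log-times, `A_{n+1} = ∫_ℝ ‖W_{n+1}‖` the ACTION of the receiving shell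
(`C_A = fluxConst α`, `Λ = bigLam ε₀ = (1+ε₀)^{5/2}`).  The crux asks the factor `(1+ε₀)^{−a}` with `a = a(R) > 1`.  Hence:

* `EternalInviscidRate_of_actionBudget` — **the crux BY NAME** from the UNIFORM ACTION BUDGET
  `2C_AΛ⁻¹·∫_ℝ‖W_n‖ ≤ −log(1 − (1+ε₀)^{−a})` (every shell, every bounded admissible inviscid eternal solution of every `E₂(R)` table,
  all small `ε₀`, some `a = a(R) > 1`) — the EXACT threshold at which the leak mechanism alone delivers the rate.
* `neg_log_one_sub_rpow_neg_two_ge` — calibration: `−log(1 − (1+ε₀)^{−2}) ≥ log(1/ε₀) − log 2` (`(1+ε₀)^{−2} ≥ 1 − 2ε₀`).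
* `EternalInviscidRate_of_logAction` — **the crux BY NAME** (with `a = 2`) from a LOG-ACTION bound
  `2C_AΛ⁻¹·∫_ℝ‖W_n‖ ≤ θ·log(1/ε₀)` with `θ = θ(R) < 1`, for `ε₀ ≤ min εs 2^{−1/(1−θ)}`.
READING (census).  The budget is `≈ log(1/(aε₀))` in the units of `IsEternal.action`; g1's `not_survivingFwd_of_action_lt_log`
(p817388) is the K1⁰-survival shadow of the same threshold.  On a K41-type front the per-shell action is `~ 1/ε₀` (the WAKE of a passed
shell sits at amplitude `~1/T ~ 1/ε₀` for a log-time `O(1)`), so the hypothesis is NOT expected to hold on the whole class: this file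
isolates exactly what the rate crux needs BEYOND the leak ratchet — an `O(log(1/ε₀))` EFFECTIVE action, i.e. near-orthogonality of
`W_{n+1}` and `A(W_n)` in the wake (the flux bound `|F_n| ≤ 2C_AΛ⁻¹‖W_{n+1}‖E_n` is what is wasteful there), not a smaller leak constant.
MODEL lattice only (Tao 2016 §4 renormalised cascade); nothing here is a statement about the Navier–Stokes equations; no stub of the
registered skeleton d183ebc2 is closed by this file; no summit is proved by it.
[cite: Tao2016AveragedNS, §4 Lemma 4.1 (4.8)–(4.10) with the cancellation (4.3), §6.4]
-/

noncomputable section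

set_option linter.dupNamespace false

open Filter Topology Set MeasureTheory
open Literature.Analysis.FluidPDE Literature.Analysis.FluidPDE.TaoCascade
open Summit.NavierStokesRegularity.NavierStokesRegularity.Theorems

namespace Summit.NavierStokesRegularity.NavierStokesRegularity.Cruxes.EternalInviscidRate.FinalWakeLedger

/-- **K1⁰ RATE BY NAME from the UNIFORM ACTION BUDGET.**  If for every spread `R ≥ 1` there are `a > 1` and `εs > 0` such that for
all `0 < ε₀ ≤ εs`, every table of `E₂(R)`, every uniformly bounded admissible inviscid eternal solution `W` and every shell `n`,
`2·C_A·Λ⁻¹·∫_ℝ ‖W_n‖ ≤ −log(1 − (1+ε₀)^{−a})`, then `WakeRatchet.EternalInviscidRate` holds (with the same `a`, `εs`).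
Proof: the landed leak ratchet `tail_succ_le_leak_envelope` and `1 − e^{−budget} ≤ (1+ε₀)^{−a}`.  MODEL lattice only.
[cite: Tao2016AveragedNS, §4 Lemma 4.1 (4.8)–(4.10) with (4.3), §6.4] -/
theorem EternalInviscidRate_of_actionBudget
    (h : ∀ R : ℝ, 1 ≤ R → ∃ a : ℝ, 1 < a ∧ ∃ εs : ℝ, 0 < εs ∧ ∀ ε₀ : ℝ, 0 < ε₀ → ε₀ ≤ εs →
      ∀ α : Fin 4 → Fin 4 → Fin 4 → ℤ × ℤ × ℤ → ℝ, InTableClass R α →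
      ∀ W : ℤ → ℝ → Em 4, IsEternal ε₀ α W → UniformBound W →
      ∀ n : ℤ, 2 * fluxConst α * (bigLam ε₀)⁻¹ * ∫ σ, ‖W n σ‖ ≤ -Real.log (1 - (1 + ε₀) ^ (-a))) :
    Summit.NavierStokesRegularity.NavierStokesRegularity.Theses.WakeRatchet.EternalInviscidRate := by
  intro R hR
  obtain ⟨a, ha, εs, hεs, H⟩ := h R hR
  refine ⟨a, ha, εs, hεs, ?_⟩
  intro ε₀ hε₀ hle α hα W hW hU n M hM σ
  have hc : IsCancellingCoeff α := hα.2.1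
  obtain ⟨Mact, hact⟩ := hW.action
  -- the leak ratchet with the receiving shell's own action
  have key := tail_succ_le_leak_envelope hε₀ hc hW hU n hM (hact (n + 1)).1 le_rfl σ
  -- `0 < 1 - (1+ε₀)^{-a} < 1`
  have h1ε : 1 < 1 + ε₀ := by linarith
  have hqlt : (1 + ε₀) ^ (-a) < 1 := Real.rpow_lt_one_of_one_lt_of_neg h1ε (by linarith)
  have hqpos : 0 < (1 + ε₀) ^ (-a) := Real.rpow_pos_of_pos (by linarith) _
  have hupos : 0 < 1 - (1 + ε₀) ^ (-a) := by linarith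
  -- `exp(−budget) ≥ 1 − (1+ε₀)^{−a}`
  have hB := H ε₀ hε₀ hle α hα W hW hU (n + 1)
  have hexp : 1 - (1 + ε₀) ^ (-a) ≤
      Real.exp (-(2 * fluxConst α * (bigLam ε₀)⁻¹ * ∫ σ, ‖W (n + 1) σ‖)) := by
    calc 1 - (1 + ε₀) ^ (-a) = Real.exp (Real.log (1 - (1 + ε₀) ^ (-a))) := (Real.exp_log hupos).symm
      _ ≤ Real.exp (-(2 * fluxConst α * (bigLam ε₀)⁻¹ * ∫ σ, ‖W (n + 1) σ‖)) :=
          Real.exp_le_exp.mpr (by linarith)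
  have hM0 : 0 ≤ M := (tsum_nonneg fun k => physEnergy_nonneg _ _ _ _).trans (hM σ)
  calc ∑' k : ℕ, physEnergy ε₀ W (n + 1 + k) σ
      ≤ (1 - Real.exp (-(2 * fluxConst α * (bigLam ε₀)⁻¹ * ∫ σ, ‖W (n + 1) σ‖))) * M := key
    _ ≤ (1 + ε₀) ^ (-a) * M := mul_le_mul_of_nonneg_right (by linarith) hM0

/-- Calibration of the budget at `a = 2`: `(1+ε₀)^{−2} ≥ 1 − 2ε₀`, hence `−log(1 − (1+ε₀)^{−2}) ≥ log(1/ε₀) − log 2 = −log(2ε₀)`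
for `0 < ε₀ < 1/2`.  Elementary.  [cite: Tao2016AveragedNS, §4 (scale ratio `1+ε₀`); elementary calculus] -/
theorem neg_log_one_sub_rpow_neg_two_ge {ε₀ : ℝ} (hε₀ : 0 < ε₀) (hε : ε₀ < 1 / 2) :
    -Real.log (2 * ε₀) ≤ -Real.log (1 - (1 + ε₀) ^ (-(2 : ℝ))) := by
  have h1ε : 0 < 1 + ε₀ := by linarith
  -- `(1+ε₀)^{-2} = ((1+ε₀)^2)⁻¹ ≥ 1 - 2ε₀`
  have hrpow : (1 + ε₀) ^ (-(2 : ℝ)) = ((1 + ε₀) ^ 2)⁻¹ := by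
    rw [Real.rpow_neg h1ε.le, Real.rpow_two]
  have hsq : 0 < (1 + ε₀) ^ 2 := by positivity
  have hbern : 1 - 2 * ε₀ ≤ ((1 + ε₀) ^ 2)⁻¹ := by
    rw [inv_eq_one_div, le_div_iff₀ hsq]
    have hid : (1 - 2 * ε₀) * (1 + ε₀) ^ 2 = 1 - 3 * ε₀ ^ 2 - 2 * ε₀ ^ 3 := by ring
    rw [hid]
    nlinarith [pow_pos hε₀ 2, pow_pos hε₀ 3]
  have hupos : 0 < 1 - (1 + ε₀) ^ (-(2 : ℝ)) := by
    rw [hrpow]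
    have : ((1 + ε₀) ^ 2)⁻¹ < 1 := inv_lt_one_of_one_lt₀ (by nlinarith)
    linarith
  have hle : 1 - (1 + ε₀) ^ (-(2 : ℝ)) ≤ 2 * ε₀ := by rw [hrpow]; linarith
  have := Real.log_le_log hupos hle
  linarith

/-- **K1⁰ RATE BY NAME from a LOG-ACTION bound.**  If for every spread `R ≥ 1` there are `θ < 1` and `εs > 0` such that for all
`0 < ε₀ ≤ εs`, every table of `E₂(R)`, every uniformly bounded admissible inviscid eternal solution and every shell,
`2·C_A·Λ⁻¹·∫_ℝ ‖W_n‖ ≤ θ·log(1/ε₀)`, then `WakeRatchet.EternalInviscidRate` holds (with `a = 2` and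
`εs' = min εs (min (1/4) (2^{−1/(1−θ)}))`).  MODEL lattice only.
[cite: Tao2016AveragedNS, §4 Lemma 4.1 (4.8)–(4.10) with (4.3), §6.4] -/
theorem EternalInviscidRate_of_logAction
    (h : ∀ R : ℝ, 1 ≤ R → ∃ θ : ℝ, θ < 1 ∧ ∃ εs : ℝ, 0 < εs ∧ ∀ ε₀ : ℝ, 0 < ε₀ → ε₀ ≤ εs →
      ∀ α : Fin 4 → Fin 4 → Fin 4 → ℤ × ℤ × ℤ → ℝ, InTableClass R α →
      ∀ W : ℤ → ℝ → Em 4, IsEternal ε₀ α W → UniformBound W →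
      ∀ n : ℤ, 2 * fluxConst α * (bigLam ε₀)⁻¹ * ∫ σ, ‖W n σ‖ ≤ θ * Real.log (1 / ε₀)) :
    Summit.NavierStokesRegularity.NavierStokesRegularity.Theses.WakeRatchet.EternalInviscidRate := by
  refine EternalInviscidRate_of_actionBudget fun R hR => ?_
  obtain ⟨θ, hθ, εs, hεs, H⟩ := h R hR
  -- the smallness window: `ε₀ ≤ εs`, `ε₀ ≤ 1/4`, `ε₀ ≤ 2^{-1/(1-θ)}`
  set ε₁ : ℝ := (2 : ℝ) ^ (-(1 / (1 - θ))) with hε₁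
  have hε₁pos : 0 < ε₁ := Real.rpow_pos_of_pos (by norm_num) _
  refine ⟨2, by norm_num, min εs (min (1 / 4) ε₁), lt_min hεs (lt_min (by norm_num) hε₁pos), ?_⟩
  intro ε₀ hε₀ hle α hα W hW hU n
  have hleεs : ε₀ ≤ εs := hle.trans (min_le_left _ _)
  have hle4 : ε₀ ≤ 1 / 4 := hle.trans ((min_le_right _ _).trans (min_le_left _ _))
  have hleε₁ : ε₀ ≤ ε₁ := hle.trans ((min_le_right _ _).trans (min_le_right _ _))
  have hB := H ε₀ hε₀ hleεs α hα W hW hU n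
  -- `θ·log(1/ε₀) ≤ log(1/ε₀) − log 2 = −log(2ε₀)` because `ε₀ ≤ 2^{−1/(1−θ)}`
  have h1θ : 0 < 1 - θ := by linarith
  have hlogε : Real.log ε₀ ≤ -(1 / (1 - θ)) * Real.log 2 := by
    have := Real.log_le_log hε₀ hleε₁
    rwa [hε₁, Real.log_rpow (by norm_num : (0 : ℝ) < 2)] at this
  have hlog2 : Real.log 2 ≤ (1 - θ) * Real.log (1 / ε₀) := by
    rw [one_div, Real.log_inv]
    have h' : (1 - θ) * Real.log ε₀ ≤ (1 - θ) * (-(1 / (1 - θ)) * Real.log 2) :=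
      mul_le_mul_of_nonneg_left hlogε h1θ.le
    have h'' : (1 - θ) * (-(1 / (1 - θ)) * Real.log 2) = -Real.log 2 := by
      field_simp
    linarith
  have hstep : θ * Real.log (1 / ε₀) ≤ -Real.log (2 * ε₀) := by
    rw [Real.log_mul (by norm_num) hε₀.ne', one_div, Real.log_inv] at *
    linarith
  have hcal := neg_log_one_sub_rpow_neg_two_ge hε₀ (by linarith)
  calc 2 * fluxConst α * (bigLam ε₀)⁻¹ * ∫ σ, ‖W n σ‖ ≤ θ * Real.log (1 / ε₀) := hB
    _ ≤ -Real.log (2 * ε₀) := hstep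
    _ ≤ -Real.log (1 - (1 + ε₀) ^ (-(2 : ℝ))) := hcal

end Summit.NavierStokesRegularity.NavierStokesRegularity.Cruxes.EternalInviscidRate.FinalWakeLedger

end
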